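import Literature.FieldTheory.FunctionField.RationalAutomorphismsPGL2
import Literature.FieldTheory.FunctionField.RationalFixedFieldNormTrace
import Literature.FieldTheory.FunctionField.RationalAffineFixingGroup
import HarnessLib

/-!
# The fixing group of a polynomial is affine; `G(x²(x−1)²) = {x, 1 − x}` over every field
# (Gutierrez–Sevilla 2006, Theorem 14 (i); Gutierrez–Sevilla 2008, Theorem 9 (iii)–(iv))

Topic `Literature/FieldTheory/FunctionField`; namespace `Literature.FieldTheory.FunctionField`.  THEOREMS ONLY
(no definition, no named fact, no instance, no notation; net Literature debt 0).  Sequel BY IMPORT of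
`RationalAutomorphismsPGL2` (the Bruhat form «`Γ₀ ∪ {1/x}` generates `Γ`»: `algEquiv_affine_or_affine_inv_affine`),
`RationalFixingGroup` (`G(f) = (K(f)).fixingSubgroup`, `mem_fixingSubgroup_adjoin_iff`, `algEquiv_ext_of_apply_X_eq`,
`card_fixingSubgroup_adjoin_eq_iff_isGalois`), `RationalFixedFieldNormTrace` (`exists_algEquiv_apply_X_eq_one_sub_X`,
`one_sub_X_involutive`, `card_zpowers_eq_two_of_involutive`, `fixedField_zpowers_one_sub_X`), `RationalAffineFixingGroup`
/ `RationalAdditiveDecompositions` (`ratFunc_algEquiv_apply_algebraMap`), `RationalPolynomialDecompositions`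
(`algebraMap_comp_eq_aeval`, `max_natDegree_algebraMap`, `algebraMap_eq_C_iff_natDegree_eq_zero`) and Mathlib
(`Polynomial.eval₂_reverse_mul_pow`, `coeff_zero_reverse`, `leadingCoeff_comp`, `leadingCoeff_linear`) — REUSED, nothing
restated.

## Sources, VERBATIM

J. Gutierrez, D. Sevilla [GutierrezSevilla2006] (held `paper:arxiv-0803.3976`), §3 Definition 15 «For any `K`,
`Γ₀ = Γ ∩ K[x] = {ax + b : a ∈ K*, b ∈ K}`.»; Theorem 14 «(i) Given a non-constant `f ∈ K(x)`, `|G(f)|` divides `deg f`.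
Moreover, for any field `K` there is always a function `f ∈ K(x)` such that `1 < |G(f)| < deg f`. […] Proof. For the
first item, we take `f = x²(x−1)²` gives `G(f) = {x, 1 − x}`.»  (The divisibility is the tree's
`card_fixingSubgroup_adjoin_dvd`.)

J. Gutierrez, D. Sevilla [GutierrezSevilla2008] (held `paper:arxiv-0804.1687`), §3 Theorem 9 «Let `f ∈ K(x)` of degree
`m` in normal form and `u = (ax + b)/(cx + d)` such that `f ∘ u = f`. (i) `a ≠ 0` and `d ≠ 0`. (ii) `f_N(b/d) = 0`.
(iii) If `c = 0` (that is, we take `u = ax + b`), then `f_N(b) = 0` and `a^m = 1`. (iv) If `c ≠ 0` then `f_D(a/c) = 0`.»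
(for a POLYNOMIAL `f`, `f_D = 1` has no zero, so (iv) says `c = 0`: every element of `G(f)` is affine); proof of Theorem 8
«If `1 < |G(f)| < deg f`, we have `K(f) ⊊ K(Fix(G(f))) ⊊ K(x)` and any generator of `K(Fix(G(f)))` is a proper component
of `f` on the right.»

## What is proved (`K` ANY field; `Γ = RatFunc K ≃ₐ[K] RatFunc K`, `G(f) = (K(f)).fixingSubgroup`, `u = RatFunc.X`)

* §1 `algEquiv_apply_algebraMap_of_apply_X_eq` (`σ(F) = F ∘ ℓ` when `σ(u) = ℓ(u) ∈ K[u]`),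
  `mem_fixingSubgroup_adjoin_algebraMap_iff_comp_eq` (`σ ∈ G(F) ⟺ F ∘ ℓ = F`), `aeval_inv_X_mul_X_pow`
  (`F(1/u)·u^{deg F} = F^{rev}(u)`).
* §2 **`exists_apply_X_eq_affine_of_mem_fixingSubgroup_adjoin_algebraMap`** — THE FIXING GROUP OF A NON-CONSTANT
  POLYNOMIAL IS AFFINE: `σ ∈ G(F) ⟹ σ(u) = au + b`, `a ≠ 0` (Theorem 9 (iv) for polynomials, WITHOUT the normal-form
  hypothesis; recorded deviation: instead of the constant term of the numerator of `f ∘ u` we use the Bruhat form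
  `σ = τ₁ ∘ (1/u) ∘ τ₂` of a non-affine `σ`, under which `σ(F) = F` becomes `F · ℓ₁^n = F₂^{rev} ∘ ℓ₁` in `K[u]`
  (`F₂ = F ∘ ℓ₂`, `n = deg F`), impossible at the zero of `ℓ₁` since `F₂^{rev}(0) = lc F₂ ≠ 0`);
  **`exists_affine_comp_eq_of_mem_fixingSubgroup_adjoin_algebraMap`** (then `F ∘ (au + b) = F`, `a^{deg F} = 1` and
  `F(b) = F(0)` — Theorem 9 (iii)).
* §3 the example `F = u²(u − 1)²` over EVERY field: `X_sq_mul_X_sub_one_sq_comp_affine_eq_iff` (`F ∘ (au + b) = F` iff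
  `(a, b) ∈ {(1, 0), (−1, 1)}`, by evaluating at `0` and `1`), **`coe_fixingSubgroup_adjoin_X_sq_mul_X_sub_one_sq`**
  (`G(F) = {σ : σ(u) ∈ {u, 1 − u}}` EXACTLY), `fixingSubgroup_adjoin_X_sq_mul_X_sub_one_sq_eq_zpowers` (`G(F) = ⟨u ↦ 1 − u⟩`),
  **`card_fixingSubgroup_adjoin_X_sq_mul_X_sub_one_sq`** (`|G(F)| = 2`), `max_natDegree_X_sq_mul_X_sub_one_sq`
  (`deg F = 4`), **`fixedField_fixingSubgroup_adjoin_X_sq_mul_X_sub_one_sq`** (`Fix(G(F)) = K(u(1 − u))`, the proper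
  right component of the proof of Theorem 8), `not_isGalois_adjoin_X_sq_mul_X_sub_one_sq`.
* §4 **`exists_one_lt_card_fixingSubgroup_adjoin_lt`** — THEOREM 14 (i), second sentence: over every field there is
  `f` with `1 < |G(f)| < deg f`.
-/

noncomputable section

open Polynomial IntermediateField

namespace Literature.FieldTheory.FunctionField

variable {K : Type*} [Field K]

/-! ### §1. `σ(F)` for an affine `σ` and for `u ↦ 1/u` -/

/-- `σ(F(u)) = F(ℓ(u)) = (F ∘ ℓ)(u)` when `σ(u) = ℓ(u)` is a polynomial. [cite: GutierrezSevilla2008, §3 Def. 4 («f ∘ u = f»)] -/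
theorem algEquiv_apply_algebraMap_of_apply_X_eq {σ : RatFunc K ≃ₐ[K] RatFunc K} {ℓ : K[X]}
    (hσ : σ RatFunc.X = algebraMap K[X] (RatFunc K) ℓ) (F : K[X]) :
    σ (algebraMap K[X] (RatFunc K) F) = algebraMap K[X] (RatFunc K) (F.comp ℓ) := by
  rw [ratFunc_algEquiv_apply_algebraMap, hσ, algebraMap_comp_eq_aeval]

/-- For `σ(u) = ℓ(u) ∈ K[u]`: `σ ∈ G(F)` iff `F ∘ ℓ = F` in `K[u]`. [cite: GutierrezSevilla2008, §3 Def. 4, Thm 9 (iii)] -/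
theorem mem_fixingSubgroup_adjoin_algebraMap_iff_comp_eq {σ : RatFunc K ≃ₐ[K] RatFunc K} {ℓ : K[X]}
    (hσ : σ RatFunc.X = algebraMap K[X] (RatFunc K) ℓ) (F : K[X]) :
    σ ∈ (IntermediateField.adjoin K ({algebraMap K[X] (RatFunc K) F} : Set (RatFunc K))).fixingSubgroup ↔
      F.comp ℓ = F := by
  rw [mem_fixingSubgroup_adjoin_iff, algEquiv_apply_algebraMap_of_apply_X_eq hσ]
  exact ⟨fun h => IsFractionRing.injective K[X] (RatFunc K) h, fun h => by rw [h]⟩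

/-- `F(1/u) · u^{deg F} = F^{rev}(u)` (the reversed polynomial), i.e. «if we consider `f(1/x)`, its numerator …»:
`F(1/u) = F^{rev}(u)/u^{deg F}`. [cite: GutierrezSevilla2008, §3 Thm 9 (i) (proof)] -/
theorem aeval_inv_X_mul_X_pow (F : K[X]) :
    aeval (RatFunc.X : RatFunc K)⁻¹ F * RatFunc.X ^ F.natDegree =
      algebraMap K[X] (RatFunc K) F.reverse := by
  haveI : Invertible ((RatFunc.X : RatFunc K)⁻¹) := invertibleOfNonzero (inv_ne_zero RatFunc.X_ne_zero)
  have h := eval₂_reverse_mul_pow (algebraMap K (RatFunc K)) ((RatFunc.X : RatFunc K)⁻¹) F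
  rw [invOf_eq_inv, inv_inv, ← aeval_def, ← aeval_def, RatFunc.aeval_X_left_eq_algebraMap] at h
  rw [← h, mul_assoc, ← mul_pow, inv_mul_cancel₀ RatFunc.X_ne_zero, one_pow, mul_one]

/-! ### §2. The fixing group of a polynomial consists of affine substitutions -/

/-- «composing on the right with `cx + d` does not change those degrees»: `deg (F ∘ (au + b)) = deg F` for `a ≠ 0`.
[cite: GutierrezSevilla2008, §3 Thm 9 (i) (proof)] -/
theorem natDegree_comp_affine (F : K[X]) {a : K} (ha : a ≠ 0) (b : K) :
    (F.comp (C a * X + C b)).natDegree = F.natDegree := by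
  rw [natDegree_comp, natDegree_add_C, natDegree_C_mul_X a ha, mul_one]

/-- **The fixing group of a non-constant polynomial is affine**: if `F ∈ K[u]`, `deg F ≥ 1`, and `σ ∈ G(F)`, then
`σ(u) = au + b` with `a ≠ 0` — Theorem 9 (iv) «If `c ≠ 0` then `f_D(a/c) = 0`» for a polynomial (`f_D = 1`), here for
every non-constant polynomial (no normal form needed).  Proof (recorded deviation): a non-affine `σ` is
`τ₁ ∘ ι ∘ τ₂` with `τᵢ(u) = aᵢu + bᵢ`, `ι(u) = 1/u` (Bruhat form); then `σ(F) = F` reads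
`F · (a₁u + b₁)^n = F₂^{rev} ∘ (a₁u + b₁)` in `K[u]` with `F₂ = F ∘ (a₂u + b₂)`, `n = deg F ≥ 1`, and evaluating at
`u = −b₁/a₁` gives `0 = F₂^{rev}(0) = lc F₂ ≠ 0`. [cite: GutierrezSevilla2008, §3 Thm 9 (iv)]
[cite: GutierrezSevilla2006, §3 Def. 15 (Γ₀ = Γ ∩ K[x] = {ax + b})] -/
theorem exists_apply_X_eq_affine_of_mem_fixingSubgroup_adjoin_algebraMap {F : K[X]}
    (hF : F.natDegree ≠ 0) {σ : RatFunc K ≃ₐ[K] RatFunc K}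
    (hσ : σ ∈ (IntermediateField.adjoin K ({algebraMap K[X] (RatFunc K) F} : Set (RatFunc K))).fixingSubgroup) :
    ∃ a b : K, a ≠ 0 ∧ σ RatFunc.X = algebraMap K[X] (RatFunc K) (C a * X + C b) := by
  rcases algEquiv_affine_or_affine_inv_affine σ with
    haff | ⟨τ₁, ι, τ₂, a₁, b₁, a₂, b₂, ha₁, ha₂, h₁, h₂, hι, rfl⟩
  · exact haff
  exfalso
  rw [mem_fixingSubgroup_adjoin_iff, AlgEquiv.mul_apply, AlgEquiv.mul_apply,
    algEquiv_apply_algebraMap_of_apply_X_eq h₂] at hσ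
  set F₂ : K[X] := F.comp (C a₂ * X + C b₂) with hF₂
  have hn : F₂.natDegree = F.natDegree := natDegree_comp_affine F ha₂ b₂
  have hF₂0 : F₂ ≠ 0 := fun h0 => hF (by rw [← hn, h0, natDegree_zero])
  -- `ι(F₂) · u^n = F₂^rev`
  have hιF : ι (algebraMap K[X] (RatFunc K) F₂) * RatFunc.X ^ F₂.natDegree =
      algebraMap K[X] (RatFunc K) F₂.reverse := by
    rw [ratFunc_algEquiv_apply_algebraMap, hι, aeval_inv_X_mul_X_pow]
  -- apply `τ₁`
  have h1 := congrArg τ₁ hιF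
  rw [map_mul, map_pow, h₁, algEquiv_apply_algebraMap_of_apply_X_eq h₁, hσ, ← map_pow, ← map_mul] at h1
  have key : F * (C a₁ * X + C b₁) ^ F₂.natDegree = F₂.reverse.comp (C a₁ * X + C b₁) :=
    IsFractionRing.injective K[X] (RatFunc K) h1
  -- evaluate at the zero `-b₁/a₁` of `a₁ u + b₁`
  have hℓ0 : (C a₁ * X + C b₁).eval (-b₁ / a₁) = 0 := by
    rw [eval_add, eval_mul, eval_C, eval_X, eval_C, mul_div_cancel₀ _ ha₁, neg_add_cancel]
  have h := congrArg (eval (-b₁ / a₁)) key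
  rw [eval_mul, eval_pow, hℓ0, zero_pow (hn.trans_ne hF), mul_zero, eval_comp, hℓ0,
    ← coeff_zero_eq_eval_zero, coeff_zero_reverse] at h
  exact leadingCoeff_ne_zero.mpr hF₂0 h.symm

/-- **Theorem 9 (iii) for polynomials**: if `σ ∈ G(F)` (`F ∈ K[u]` non-constant) then `σ(u) = au + b` with
`F ∘ (au + b) = F`, `a^{deg F} = 1` («`a^m = 1`», leading coefficients) and `F(b) = F(0)` («`f_N(b) = 0`» when
`F(0) = 0`, constant terms). [cite: GutierrezSevilla2008, §3 Thm 9 (iii)] -/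
theorem exists_affine_comp_eq_of_mem_fixingSubgroup_adjoin_algebraMap {F : K[X]} (hF : F.natDegree ≠ 0)
    {σ : RatFunc K ≃ₐ[K] RatFunc K}
    (hσ : σ ∈ (IntermediateField.adjoin K ({algebraMap K[X] (RatFunc K) F} : Set (RatFunc K))).fixingSubgroup) :
    ∃ a b : K, a ≠ 0 ∧ σ RatFunc.X = algebraMap K[X] (RatFunc K) (C a * X + C b) ∧
      F.comp (C a * X + C b) = F ∧ a ^ F.natDegree = 1 ∧ F.eval b = F.eval 0 := by
  obtain ⟨a, b, ha, hσX⟩ := exists_apply_X_eq_affine_of_mem_fixingSubgroup_adjoin_algebraMap hF hσ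
  have hcomp : F.comp (C a * X + C b) = F := (mem_fixingSubgroup_adjoin_algebraMap_iff_comp_eq hσX F).mp hσ
  refine ⟨a, b, ha, hσX, hcomp, ?_, ?_⟩
  · have h := congrArg leadingCoeff hcomp
    rw [leadingCoeff_comp (by rw [natDegree_add_C, natDegree_C_mul_X a ha]; exact one_ne_zero),
      leadingCoeff_linear ha] at h
    exact (mul_eq_left₀ (leadingCoeff_ne_zero.mpr fun h0 => hF (by rw [h0, natDegree_zero]))).mp h
  · have h := congrArg (eval 0) hcomp
    rwa [eval_comp, eval_add, eval_mul, eval_C, eval_X, mul_zero, zero_add, eval_C] at h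

/-! ### §3. The example `F = u²(u − 1)²`: `G(F) = {u, 1 − u}` over every field -/

/-- `deg u²(u − 1)² = 4`. [cite: GutierrezSevilla2006, §3 Thm 14 (i) (proof)] -/
theorem natDegree_X_sq_mul_X_sub_one_sq : (X ^ 2 * (X - 1) ^ 2 : K[X]).natDegree = 4 := by
  have h1 : (X - 1 : K[X]) = X - C 1 := by rw [map_one]
  rw [natDegree_mul (pow_ne_zero 2 X_ne_zero) (pow_ne_zero 2 (h1 ▸ X_sub_C_ne_zero 1)),
    natDegree_pow, natDegree_X, natDegree_pow, h1, natDegree_X_sub_C]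

/-- `deg u²(u − 1)² = 4` as a rational function. [cite: GutierrezSevilla2006, §3 Thm 14 (i) (proof)] -/
theorem max_natDegree_X_sq_mul_X_sub_one_sq :
    max (algebraMap K[X] (RatFunc K) (X ^ 2 * (X - 1) ^ 2)).num.natDegree
      (algebraMap K[X] (RatFunc K) (X ^ 2 * (X - 1) ^ 2)).denom.natDegree = 4 := by
  rw [max_natDegree_algebraMap, natDegree_X_sq_mul_X_sub_one_sq]

/-- `u²(u − 1)²` is not constant. [cite: GutierrezSevilla2006, §3 Thm 14 (i) (proof)] -/
theorem X_sq_mul_X_sub_one_sq_ne_C :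
    ¬ ∃ c, algebraMap K[X] (RatFunc K) (X ^ 2 * (X - 1) ^ 2) = RatFunc.C c := by
  rw [algebraMap_eq_C_iff_natDegree_eq_zero, natDegree_X_sq_mul_X_sub_one_sq]
  norm_num

/-- The zeros of `u²(u − 1)²` are `0` and `1`. [cite: GutierrezSevilla2006, §3 Thm 14 (i) (proof)] -/
theorem eval_X_sq_mul_X_sub_one_sq_eq_zero_iff (c : K) :
    (X ^ 2 * (X - 1) ^ 2 : K[X]).eval c = 0 ↔ c = 0 ∨ c = 1 := by
  rw [eval_mul, eval_pow, eval_pow, eval_sub, eval_X, eval_one, mul_eq_zero]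
  simp only [pow_eq_zero_iff two_ne_zero, sub_eq_zero]

/-- `F ∘ (au + b) = F` for `F = u²(u − 1)²`, `a ≠ 0`, iff `(a, b) = (1, 0)` or `(−1, 1)` — over ANY field (evaluate at
`u = 0, 1`: `b, a + b ∈ {0, 1}` are distinct). [cite: GutierrezSevilla2006, §3 Thm 14 (i) (proof: «G(f) = {x, 1 − x}»)] -/
theorem X_sq_mul_X_sub_one_sq_comp_affine_eq_iff {a : K} (ha : a ≠ 0) (b : K) :
    (X ^ 2 * (X - 1) ^ 2 : K[X]).comp (C a * X + C b) = X ^ 2 * (X - 1) ^ 2 ↔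
      (a = 1 ∧ b = 0) ∨ (a = -1 ∧ b = 1) := by
  constructor
  · intro h
    have hev : ∀ c : K, (C a * X + C b).eval c = a * c + b := fun c => by
      simp only [eval_add, eval_mul, eval_C, eval_X]
    have h0 : (X ^ 2 * (X - 1) ^ 2 : K[X]).eval b = 0 := by
      have := congrArg (eval 0) h
      rwa [eval_comp, hev, mul_zero, zero_add,
        (eval_X_sq_mul_X_sub_one_sq_eq_zero_iff 0).mpr (Or.inl rfl)] at this
    have h1 : (X ^ 2 * (X - 1) ^ 2 : K[X]).eval (a + b) = 0 := by
      have := congrArg (eval 1) h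
      rwa [eval_comp, hev, mul_one, (eval_X_sq_mul_X_sub_one_sq_eq_zero_iff 1).mpr (Or.inr rfl)] at this
    rw [eval_X_sq_mul_X_sub_one_sq_eq_zero_iff] at h0 h1
    rcases h0 with rfl | rfl
    · rw [add_zero] at h1
      rcases h1 with h1 | h1
      · exact absurd h1 ha
      · exact Or.inl ⟨h1, rfl⟩
    · rcases h1 with h1 | h1
      · exact Or.inr ⟨by linear_combination h1, rfl⟩
      · exact absurd (by linear_combination h1) ha
  · rintro (⟨rfl, rfl⟩ | ⟨rfl, rfl⟩)
    · rw [map_one, one_mul, map_zero, add_zero, comp_X]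
    · rw [map_neg, map_one, neg_one_mul, mul_comp, pow_comp, pow_comp, sub_comp, X_comp, one_comp]
      ring

/-- **`G(u²(u − 1)²) = {u, 1 − u}`** over every field: as a set of automorphisms
`G(F) = {σ : σ(u) = u ∨ σ(u) = 1 − u}` (`⊆`: §2 and the previous lemma; `⊇`: `F ∘ (1 − u) = F`).
[cite: GutierrezSevilla2006, §3 Thm 14 (i) (proof: «we take f = x²(x−1)² gives G(f) = {x, 1 − x}»)] -/
theorem coe_fixingSubgroup_adjoin_X_sq_mul_X_sub_one_sq :
    ((IntermediateField.adjoin K ({algebraMap K[X] (RatFunc K) (X ^ 2 * (X - 1) ^ 2)} :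
        Set (RatFunc K))).fixingSubgroup : Set (RatFunc K ≃ₐ[K] RatFunc K)) =
      {σ | σ RatFunc.X = RatFunc.X ∨ σ RatFunc.X = 1 - RatFunc.X} := by
  have hF : (X ^ 2 * (X - 1) ^ 2 : K[X]).natDegree ≠ 0 := by
    rw [natDegree_X_sq_mul_X_sub_one_sq]; norm_num
  have hX : (RatFunc.X : RatFunc K) = algebraMap K[X] (RatFunc K) (C 1 * X + C 0) := by
    rw [map_one, one_mul, map_zero, add_zero, RatFunc.algebraMap_X]
  have h1X : (1 - RatFunc.X : RatFunc K) = algebraMap K[X] (RatFunc K) (C (-1) * X + C 1) := by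
    rw [map_add, map_mul, RatFunc.algebraMap_C, RatFunc.algebraMap_C, RatFunc.algebraMap_X, map_neg, map_one,
      neg_one_mul, neg_add_eq_sub]
  ext σ
  simp only [SetLike.mem_coe, Set.mem_setOf_eq]
  constructor
  · intro hσ
    obtain ⟨a, b, ha, hσX, hcomp, -, -⟩ := exists_affine_comp_eq_of_mem_fixingSubgroup_adjoin_algebraMap hF hσ
    rcases (X_sq_mul_X_sub_one_sq_comp_affine_eq_iff ha b).mp hcomp with ⟨rfl, rfl⟩ | ⟨rfl, rfl⟩
    · exact Or.inl (by rw [hσX, ← hX])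
    · exact Or.inr (by rw [hσX, ← h1X])
  · rintro (h | h)
    · exact (mem_fixingSubgroup_adjoin_algebraMap_iff_comp_eq (h.trans hX) _).mpr
        ((X_sq_mul_X_sub_one_sq_comp_affine_eq_iff one_ne_zero 0).mpr (Or.inl ⟨rfl, rfl⟩))
    · exact (mem_fixingSubgroup_adjoin_algebraMap_iff_comp_eq (h.trans h1X) _).mpr
        ((X_sq_mul_X_sub_one_sq_comp_affine_eq_iff (neg_ne_zero.mpr one_ne_zero) 1).mpr (Or.inr ⟨rfl, rfl⟩))

/-- `G(u²(u − 1)²) = ⟨σ⟩` for the involution `σ(u) = 1 − u`. [cite: GutierrezSevilla2006, §3 Thm 14 (i) (proof)] -/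
theorem fixingSubgroup_adjoin_X_sq_mul_X_sub_one_sq_eq_zpowers {σ : RatFunc K ≃ₐ[K] RatFunc K}
    (hσ : σ RatFunc.X = 1 - RatFunc.X) :
    (IntermediateField.adjoin K ({algebraMap K[X] (RatFunc K) (X ^ 2 * (X - 1) ^ 2)} :
        Set (RatFunc K))).fixingSubgroup = Subgroup.zpowers σ := by
  obtain ⟨h2, _⟩ := one_sub_X_involutive hσ
  have hσ2 : σ * σ = 1 := algEquiv_ext_of_apply_X_eq (by rw [AlgEquiv.mul_apply, h2, AlgEquiv.one_apply])
  refine le_antisymm (fun τ hτ => ?_) ?_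
  · have hτ' : τ ∈ ((IntermediateField.adjoin K ({algebraMap K[X] (RatFunc K) (X ^ 2 * (X - 1) ^ 2)} :
        Set (RatFunc K))).fixingSubgroup : Set (RatFunc K ≃ₐ[K] RatFunc K)) := hτ
    rw [coe_fixingSubgroup_adjoin_X_sq_mul_X_sub_one_sq] at hτ'
    rcases hτ' with h | h
    · have : τ = 1 := algEquiv_ext_of_apply_X_eq (by rw [h, AlgEquiv.one_apply])
      rw [this]; exact one_mem _
    · have : τ = σ := algEquiv_ext_of_apply_X_eq (by rw [h, hσ])
      rw [this]; exact Subgroup.mem_zpowers σ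
  · rw [Subgroup.zpowers_le]
    show σ ∈ ((IntermediateField.adjoin K ({algebraMap K[X] (RatFunc K) (X ^ 2 * (X - 1) ^ 2)} :
        Set (RatFunc K))).fixingSubgroup : Set (RatFunc K ≃ₐ[K] RatFunc K))
    rw [coe_fixingSubgroup_adjoin_X_sq_mul_X_sub_one_sq]
    exact Or.inr hσ

/-- **`|G(u²(u − 1)²)| = 2`** over every field. [cite: GutierrezSevilla2006, §3 Thm 14 (i) (proof)] -/
theorem card_fixingSubgroup_adjoin_X_sq_mul_X_sub_one_sq :
    Nat.card (IntermediateField.adjoin K ({algebraMap K[X] (RatFunc K) (X ^ 2 * (X - 1) ^ 2)} :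
        Set (RatFunc K))).fixingSubgroup = 2 := by
  obtain ⟨σ, hσ⟩ := exists_algEquiv_apply_X_eq_one_sub_X (K := K)
  obtain ⟨h2, h1⟩ := one_sub_X_involutive hσ
  rw [fixingSubgroup_adjoin_X_sq_mul_X_sub_one_sq_eq_zpowers hσ]
  exact card_zpowers_eq_two_of_involutive h2 h1

/-- **`Fix(G(u²(u − 1)²)) = K(u(1 − u))`** (a field of index `2` in `K(u)`, strictly between `K(F)` — index `4` — and
`K(u)`): «`K(f) ⊊ K(Fix(G(f))) ⊊ K(x)` and any generator of `K(Fix(G(f)))` is a proper component of `f` on the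
right» — here `F = (u(1 − u))²`. [cite: GutierrezSevilla2008, §3 Thm 8 (proof)] [cite: GutierrezSevilla2006, §3 Thm 14 (i)] -/
theorem fixedField_fixingSubgroup_adjoin_X_sq_mul_X_sub_one_sq :
    IntermediateField.fixedField (IntermediateField.adjoin K
        ({algebraMap K[X] (RatFunc K) (X ^ 2 * (X - 1) ^ 2)} : Set (RatFunc K))).fixingSubgroup =
      IntermediateField.adjoin K ({RatFunc.X * (1 - RatFunc.X)} : Set (RatFunc K)) := by
  obtain ⟨σ, hσ⟩ := exists_algEquiv_apply_X_eq_one_sub_X (K := K)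
  rw [fixingSubgroup_adjoin_X_sq_mul_X_sub_one_sq_eq_zpowers hσ, ← (fixedField_zpowers_one_sub_X hσ).1, hσ]

/-- `K(u)/K(u²(u − 1)²)` is not Galois, over any field (`|G(F)| = 2 ≠ 4 = deg F`, Theorem 7/14 (ii)).
[cite: GutierrezSevilla2006, §3 Thm 14 (i)–(ii)] -/
theorem not_isGalois_adjoin_X_sq_mul_X_sub_one_sq :
    ¬ IsGalois (IntermediateField.adjoin K ({algebraMap K[X] (RatFunc K) (X ^ 2 * (X - 1) ^ 2)} :
        Set (RatFunc K))) (RatFunc K) := by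
  rw [← card_fixingSubgroup_adjoin_eq_iff_isGalois X_sq_mul_X_sub_one_sq_ne_C,
    card_fixingSubgroup_adjoin_X_sq_mul_X_sub_one_sq, max_natDegree_X_sq_mul_X_sub_one_sq]
  norm_num

/-! ### §4. GS2006 Theorem 14 (i): `1 < |G(f)| < deg f` happens over every field -/

/-- **Theorem 14 (i), second sentence**: «for any field `K` there is always a function `f ∈ K(x)` such that
`1 < |G(f)| < deg f`» — witness `f = x²(x − 1)²`, `|G(f)| = 2 < 4 = deg f` («we take `f = x²(x−1)²` gives
`G(f) = {x, 1 − x}`»). [cite: GutierrezSevilla2006, §3 Thm 14 (i)] -/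
theorem exists_one_lt_card_fixingSubgroup_adjoin_lt :
    ∃ f : RatFunc K, 1 < Nat.card (IntermediateField.adjoin K ({f} : Set (RatFunc K))).fixingSubgroup ∧
      Nat.card (IntermediateField.adjoin K ({f} : Set (RatFunc K))).fixingSubgroup <
        max f.num.natDegree f.denom.natDegree :=
  ⟨algebraMap K[X] (RatFunc K) (X ^ 2 * (X - 1) ^ 2), by
    rw [card_fixingSubgroup_adjoin_X_sq_mul_X_sub_one_sq, max_natDegree_X_sq_mul_X_sub_one_sq]
    norm_num⟩

end Literature.FieldTheory.FunctionField
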